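import Summits.QuantumFields.YangMills.Theorems.BalabanUVNodesN21SelectedThresholdsHistoriesResummation
import Literature.MathematicalPhysics.QuantumFieldTheory.Balaban1983to89.T4Continuum

/-!
# YM-DAG node N21 (= NE7c) — THE LEVEL-0 LAWS OF RECORD AND THEIR SOURCE TILT: module 20e's displayed input (TILT) («a level-0, K-uniformly bounded
# source», lens census aaa) DISCHARGED AT THE RECORD for loop-string sources, and 20e's road-I junction INSTANTIATED at the two runs' dressed laws of record

Track A of `YM-PLAN.md` (cell `pub-ymgap`, HUMAN RULING D-0062), node **N21**; R134 fan-out seat `pub-ymgap-dag-n21-d` (s2 = BY-NAME KNIT at the record), generation 6,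
module 23.  THEOREMS ONLY: 0 `def`, 0 `sorry`, standard axioms; COUNT-NEUTRAL; `--supports` the K3‴ item `SpineGivenEndpointR13` (stmt-QuantumFields-19912) as a helper.
`N`- and `G`-generic, NO Theses import, NO `Node00.Record13` import (restate-immune).  Imports module 20e `BalabanUVNodesN21SelectedThresholdsHistoriesResummation` (p497258:
`tilt_sandwich`, `levelLedgers_histories_of_resummation`, `shellWeightBound_histories_of_resummation`, `sum_histWeight_eq_of_resummation`; brings 20b's `withDensity_le_smul` ∕
`le_smul_withDensity`) and `T4Continuum` (`FiniteEpsData.scheme`, `FiniteEpsData.abs_avgObs_le_one`, `FiniteEpsData.measurable_avgObs`; brings `T4GenFunBounds.gibbsMeasure` ∕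
`prodObs` ∕ `schemeZ` ∕ `dressedZ` and `Missing.boltzmann` ∕ `fieldMeasure` ∕ `partitionFn`).

THE POINT.  After module 20e the histories road of N21 displays, per run X ∈ {A, B} and comparison `K`: ONE t-free finite law `γ0^X K` on NODE O's common space `Ω K`, the
source-tilted laws `γ^X_t K`, a constant `M > 0` and the two-sided sandwich (TILT) `γ^X_t ≤ M • γ0^X ∧ γ0^X ≤ M • γ^X_t` on `|t| ≤ l₀` (binders `γ0A γ0B γtA γtB hM htiltA
htiltB`), next to (RESUM), N16's closeness, N20's window, the admissible box and the rate; the lens flags the source bound behind `M` as a residual input (census aaa: a smeared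
source would make `M` depend on `K`).  AT THE RECORD these seven binders are NOT inputs.  Run X of comparison `K` of the datum `D : FiniteEpsData F G` at bare couplings `g₀`
and loop string `os` is the Wilson theory of the scheme `D.scheme g₀` at step `n` (`n = K₀ + K` for run A, `K₀ + K + 1` for run B — the steps of the K3‴ extraction clause
`KeyedExtraction`'s E1 ∕ E2), whose level-0 objects are ALREADY typed: the field space `GaugeField (F.P n) 0 G` with the product Haar measure `fieldMeasure (F.P n) 0 G`, the
Boltzmann weight `Missing.boltzmann (F.P n) ((g₀ n)⁻¹ ^ 2)`, the source `F_n := T4GenFunBounds.prodObs (D.scheme g₀) n os` (the product of the averaged loop variables of the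
string) and the dressed partition function `T4GenFunBounds.schemeZ (D.scheme g₀) os n t = ∫ e^{t F_n} e^{−βA} dU`.  So:
* run X's t-free level-0 law is the BOLTZMANN LAW `fieldMeasure.withDensity (ofReal ∘ boltzmann)` (= `Z • gibbsMeasure`, mass `Z = schemeZ … n 0`, §2), its source tilt is the
  DRESSED LAW `fieldMeasure.withDensity (U ↦ ofReal (e^{t F_n U} · boltzmann U))` (mass `schemeZ … n t` — E1's right-hand side as a measure identity, §2; its density is dag-n20-e's
  F3 `dressedStart` `e^{t·prodObs}·boltzmann` pointwise), and the dressed law IS the Boltzmann law tilted by `e^{t F_n}` (`dressedLaw_eq_withDensity_boltzmannLaw`);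
* the source is bounded BY ONE: `|F_n U| ≤ 1` for every `U`, `n`, `os`, `g₀` (`FiniteEpsData.abs_avgObs_le_one`, hypothesis-free: loop variables are normalised traces) and
  measurable under the datum's displayed proviso `D.AvgMeasurable` — hence (TILT) AT THE RECORD with `M = e^{l₀}` (`sourceTilt_sandwich`, module 20e's `tilt_sandwich` at `B_F = 1`),
  uniformly in `K`, `os`, `g₀`, `N`, `G`; in the probability-law currency the normalised tilt `(gibbsMeasure …).tilted (t·F_n)` is sandwiched against `gibbsMeasure …` with
  `M = e^{2l₀}` (§1 `tilted_sandwich`, §2 `gibbsTilted_sandwich`);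
* sandwiches travel along ANY measurable map (§1 `sandwich_map`), so whatever common space `Ω K` and embeddings `eA K`, `eB K` of the two runs' field spaces NODE O types (the lens's
  model A: the disjoint union, `Sum.inl` ∕ `Sum.inr`), the images of the laws of record satisfy (TILT) there;
* the sibling module 23b `BalabanUVNodesN21SourceTiltAtRecordLedgers` INSTANTIATES 20e's `levelLedgers_histories_of_resummation` ∕ `shellWeightBound_histories_of_resummation`
  at the images of the two runs' Boltzmann ∕ dressed laws OF RECORD (`D.scheme g₀`, steps `K₀ + K` ∕ `K₀ + K + 1`) with `M := e^{l₀}` — the seven binders gone — and reads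
  E1 of the extraction clause off (RESUM) (`schemeZ = Σ_τ A`).

HONEST FRAMING (binding).  [folklore] measure theory (`withDensity`, `Measure.tilted`, `Measure.map`) on the TYPED level-0 objects of the datum's Wilson scheme; the only fact
about Bałaban's objects used is `|avgObs| ≤ 1` (a normalised trace), proved in `T4Continuum`.  DISPLAYED after this file on the histories road: (RESUM) `Σ_τ histLaw^X_τ = (dressed
law of record).map (eX K)` = the SHAPE of NODE O's term object (a partition of unity inserted under THIS integral — nothing of Bałaban's expansion is typed here; `νX`, `uX`, `T`,
`small`, `C`, `lvl`, `Ω`, `eX` are PARAMETERS), N16's a.e. closeness by level, N20's window∕count, the admissible box, the rate `ρ_j ≤ c₁ϑ^j`, and the datum's proviso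
`AvgMeasurable`.  (M1) for print's FIXED thresholds untouched; no inhabitant of any record class claimed (K0‴ open); NE7c is NOT PRINTED and NOT PROVED; **N21 is NOT discharged**;
K3‴ NOT claimed; typed 28∕28, discharged count untouched; one finite four-torus programme at fixed `ε` — NOT ℝ⁴, NOT infinite volume, NOT OS, NOT a mass gap, NOT Clay.
No decl below carries a cite tag.
-/

set_option autoImplicit false

noncomputable section

open scoped BigOperators ENNReal
open MeasureTheory Set ProbabilityTheory

namespace Summit.QuantumFields.YangMills.Theorems.N21SourceTiltAtRecord

open Literature.MathematicalPhysics.QuantumFieldTheory.Balaban1983to89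
open Literature.MathematicalPhysics.QuantumFieldTheory.Balaban1983to89.T4Continuum (T4Family ULoop FiniteEpsData)
open T4GenFunBounds (gibbsMeasure prodObs schemeZ dressedZ)
open Missing (boltzmann partitionFn)
open T4IndicatorShell (ShellWeightBound)
open T4ShellMeasureLevels (LevelLedger LiveWindow)
open Summit.QuantumFields.BalabanUV.T4Continuum.ShellMeasureRootCompositionHistories (histWeight histShell histPiece histLaw)
open Summit.QuantumFields.YangMills.Theorems.N21SelectedThresholdsTransport (withDensity_le_smul le_smul_withDensity)
open Summit.QuantumFields.YangMills.Theorems.N21SelectedThresholdsHistoriesResummation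
  (tilt_sandwich levelLedgers_histories_of_resummation shellWeightBound_histories_of_resummation sum_histWeight_eq_of_resummation)

/-! ## §1 [folklore] sandwiches travel: push-forward, scaling; the normalised tilt of a probability law -/

section Generic

variable {X Y : Type*} [MeasurableSpace X] [MeasurableSpace Y]

/-- a two-sided sandwich `γt ≤ M • γ0 ∧ γ0 ≤ M • γt` is preserved by the push-forward along any measurable map (`Measure.map_mono`, `Measure.map_smul`) —
so (TILT) for the laws of record holds on whatever common space the two runs' field spaces are embedded in. [folklore] -/
theorem sandwich_map {γt γ0 : Measure X} {M : ℝ≥0∞} (h : γt ≤ M • γ0 ∧ γ0 ≤ M • γt) {e : X → Y} (he : Measurable e) :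
    γt.map e ≤ M • γ0.map e ∧ γ0.map e ≤ M • γt.map e := by
  refine ⟨?_, ?_⟩
  · simpa only [Measure.map_smul] using Measure.map_mono h.1 he
  · simpa only [Measure.map_smul] using Measure.map_mono h.2 he

/-- … and by scaling both measures by one constant (e.g. the normalisation `Z⁻¹` turning the Boltzmann law into the Gibbs law). [folklore] -/
theorem sandwich_smul {γt γ0 : Measure X} {M : ℝ≥0∞} (h : γt ≤ M • γ0 ∧ γ0 ≤ M • γt) (c : ℝ≥0∞) :
    c • γt ≤ M • (c • γ0) ∧ c • γ0 ≤ M • (c • γt) := by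
  refine ⟨Measure.le_iff'.2 fun s => ?_, Measure.le_iff'.2 fun s => ?_⟩
  · have := Measure.le_iff'.1 h.1 s
    simp only [Measure.smul_apply, smul_eq_mul] at this ⊢
    calc c * γt s ≤ c * (M * γ0 s) := by gcongr
      _ = M * (c * γ0 s) := mul_left_comm _ _ _
  · have := Measure.le_iff'.1 h.2 s
    simp only [Measure.smul_apply, smul_eq_mul] at this ⊢
    calc c * γ0 s ≤ c * (M * γt s) := by gcongr
      _ = M * (c * γt s) := mul_left_comm _ _ _

/-- **THE NORMALISED SOURCE TILT OF A PROBABILITY LAW IS A TWO-SIDED SANDWICH WITH CONSTANT `e^{2l₀B}`**: for `|F| ≤ B`, `|t| ≤ l₀`, Mathlib's `μ.tilted (t·F)`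
(density `e^{tF}∕∫e^{tF}dμ ∈ [e^{−2l₀B}, e^{2l₀B}]`, the two mgf bounds of `T4GenFunBounds` §1) satisfies `μ.tilted (t·F) ≤ e^{2l₀B} • μ` and `μ ≤ e^{2l₀B} • μ.tilted (t·F)`. [folklore] -/
theorem tilted_sandwich (μ : Measure X) [IsProbabilityMeasure μ] {F : X → ℝ} (hF : Measurable F) {B l₀ t : ℝ} (hB : ∀ x, |F x| ≤ B)
    (ht : |t| ≤ l₀) :
    μ.tilted (fun x => t * F x) ≤ ENNReal.ofReal (Real.exp (2 * (l₀ * B))) • μ ∧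
    μ ≤ ENNReal.ofReal (Real.exp (2 * (l₀ * B))) • μ.tilted (fun x => t * F x) := by
  have hl₀ : 0 ≤ l₀ := (abs_nonneg t).trans ht
  have hbd : ∀ x, |t * F x| ≤ l₀ * B := fun x => by
    rw [abs_mul]; exact mul_le_mul ht (hB x) (abs_nonneg _) hl₀
  have htB : |t| * B ≤ l₀ * B := by
    rcases le_or_gt 0 B with hB0 | hB0
    · exact mul_le_mul_of_nonneg_right ht hB0
    · -- `B < 0` contradicts `|F x| ≤ B` at any point; a probability space is nonempty
      exfalso
      have hne : (Set.univ : Set X).Nonempty := by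
        by_contra h
        rw [Set.not_nonempty_iff_eq_empty] at h
        have := measure_univ (μ := μ)
        rw [h, measure_empty] at this
        exact zero_ne_one this
      obtain ⟨x, -⟩ := hne
      exact (lt_irrefl _) ((hB0.trans_le (abs_nonneg (F x))).trans_le (hB x))
  have hae : ∀ᵐ x ∂μ, |F x| ≤ B := Filter.Eventually.of_forall hB
  -- the normalising integral is the mgf, in `[e^{−|t|B}, e^{|t|B}]`
  have hZ : ∫ x, Real.exp (t * F x) ∂μ = mgf F μ t := rfl
  have hZup : mgf F μ t ≤ Real.exp (|t| * B) := by
    simpa [probReal_univ] using T4GenFunBounds.mgf_le_of_abs_le (μ := μ) (X := F) hae t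
  have hZlo : Real.exp (-(|t| * B)) ≤ mgf F μ t := by
    simpa [probReal_univ] using T4GenFunBounds.exp_neg_le_mgf_of_abs_le (μ := μ) hF.aemeasurable hae t
  have hZpos : 0 < mgf F μ t := (Real.exp_pos _).trans_le hZlo
  -- pointwise bounds on the density
  have hnum_up : ∀ x, Real.exp (t * F x) ≤ Real.exp (|t| * B) := fun x =>
    Real.exp_le_exp.2 ((le_abs_self _).trans ((abs_mul t (F x)).symm ▸ mul_le_mul_of_nonneg_left (hB x) (abs_nonneg t)))
  have hnum_lo : ∀ x, Real.exp (-(|t| * B)) ≤ Real.exp (t * F x) := fun x =>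
    Real.exp_le_exp.2 (by
      have h1 : |t * F x| ≤ |t| * B := (abs_mul t (F x)).symm ▸ mul_le_mul_of_nonneg_left (hB x) (abs_nonneg t)
      linarith [neg_abs_le (t * F x)])
  have h2 : Real.exp (|t| * B) / Real.exp (-(|t| * B)) = Real.exp (2 * (|t| * B)) := by
    rw [← Real.exp_sub]; ring_nf
  have h2le : Real.exp (2 * (|t| * B)) ≤ Real.exp (2 * (l₀ * B)) := Real.exp_le_exp.2 (by linarith)
  have hdens_up : ∀ x, Real.exp (t * F x) / mgf F μ t ≤ Real.exp (2 * (l₀ * B)) := fun x =>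
    calc Real.exp (t * F x) / mgf F μ t ≤ Real.exp (|t| * B) / Real.exp (-(|t| * B)) :=
          div_le_div₀ (Real.exp_pos _).le (hnum_up x) (Real.exp_pos _) hZlo
      _ = Real.exp (2 * (|t| * B)) := h2
      _ ≤ Real.exp (2 * (l₀ * B)) := h2le
  have hdens_lo : ∀ x, 1 ≤ Real.exp (2 * (l₀ * B)) * (Real.exp (t * F x) / mgf F μ t) := fun x => by
    rw [mul_div_assoc', le_div_iff₀ hZpos, one_mul]
    calc mgf F μ t ≤ Real.exp (|t| * B) := hZup
      _ = Real.exp (2 * (|t| * B)) * Real.exp (-(|t| * B)) := by rw [← Real.exp_add]; ring_nf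
      _ ≤ Real.exp (2 * (l₀ * B)) * Real.exp (t * F x) :=
          mul_le_mul h2le (hnum_lo x) (Real.exp_pos _).le (Real.exp_pos _).le
  have hmeas : Measurable fun x => ENNReal.ofReal (Real.exp (t * F x) / ∫ x, Real.exp (t * F x) ∂μ) :=
    ((Real.measurable_exp.comp (measurable_const.mul hF)).div_const _).ennreal_ofReal
  refine ⟨withDensity_le_smul μ fun x => ?_, le_smul_withDensity μ hmeas fun x => ?_⟩
  · rw [hZ]; exact ENNReal.ofReal_le_ofReal (hdens_up x)
  · rw [hZ, ← ENNReal.ofReal_mul (Real.exp_pos _).le, ← ENNReal.ofReal_one]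
    exact ENNReal.ofReal_le_ofReal (hdens_lo x)

end Generic

/-! ## §2 The level-0 laws of ONE run of a torus scheme at step `n`: Boltzmann law, dressed law, Gibbs law; the source bound; (TILT) with `M = e^{l₀}`; masses = `schemeZ` -/

section Scheme

variable {G : Type*} [GaugeGroup G] [MeasurableSpace G] [HaarData G] [RegularGaugeGroup G] {O : Type*}
  (S : Missing.TorusScheme G O) (n : ℕ) (os : List O)

/-! The three laws of run «step `n` of `S`» (all EXISTING terms, no definition is introduced):
* the BOLTZMANN LAW `(fieldMeasure (S.P n) 0 G).withDensity (U ↦ ofReal (boltzmann (S.P n) (S.β n) U))` (t-free, finite, mass `Z_n = schemeZ S os n 0`);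
* the DRESSED LAW `(fieldMeasure (S.P n) 0 G).withDensity (U ↦ ofReal (e^{t·prodObs S n os U} · boltzmann (S.P n) (S.β n) U))` (mass `Z_n(t) = schemeZ S os n t`);
* the GIBBS LAW `gibbsMeasure (S.P n) (S.β n) = Z_n⁻¹ • Boltzmann law` (probability) and its tilts.
At the scheme `D.scheme g₀` of a datum: `(D.scheme g₀).P n = F.P n`, `(D.scheme g₀).β n = (g₀ n)⁻¹ ^ 2`, `(D.scheme g₀).obs n C = D.avgObs n C` (all `rfl`). -/

omit [GaugeGroup G] [HaarData G] [RegularGaugeGroup G] in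
/-- the tilt density `U ↦ ofReal (e^{t F_n U})` of a scheme with measurable observables is measurable. [folklore] -/
theorem measurable_ofReal_exp_source (hm : ∀ K o, Measurable (S.obs K o)) (t : ℝ) :
    Measurable fun U : GaugeField (S.P n) 0 G => ENNReal.ofReal (Real.exp (t * prodObs S n os U)) :=
  (Real.measurable_exp.comp (measurable_const.mul (T4GenFunBounds.measurable_prodObs S hm n os))).ennreal_ofReal

omit [GaugeGroup G] [HaarData G] [RegularGaugeGroup G] in
/-- **(TILT), ANY REFERENCE LAW**: for EVERY measure `γ0` on the run's level-0 field space, its tilt by a source `e^{t F_n}` with `|obs| ≤ 1` (so `|F_n| ≤ 1`,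
`T4GenFunBounds.abs_prodObs_le_one`) satisfies `γ0·e^{tF_n} ≤ e^{l₀} • γ0` and `γ0 ≤ e^{l₀} • γ0·e^{tF_n}` on `|t| ≤ l₀` — module 20e's `tilt_sandwich` at `B_F = 1`.
The constant `e^{l₀}` is uniform in the step, the string, the couplings: census aaa of the lens is DISCHARGED for loop-string sources. [folklore] -/
theorem sourceTilt_sandwich (hm : ∀ K o, Measurable (S.obs K o)) (h1 : ∀ K o U, |S.obs K o U| ≤ 1)
    (γ0 : Measure (GaugeField (S.P n) 0 G)) {l₀ t : ℝ} (ht : |t| ≤ l₀) :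
    γ0.withDensity (fun U => ENNReal.ofReal (Real.exp (t * prodObs S n os U))) ≤ ENNReal.ofReal (Real.exp l₀) • γ0 ∧
    γ0 ≤ ENNReal.ofReal (Real.exp l₀) • γ0.withDensity (fun U => ENNReal.ofReal (Real.exp (t * prodObs S n os U))) := by
  simpa only [mul_one] using
    tilt_sandwich γ0 (T4GenFunBounds.measurable_prodObs S hm n os) (BF := 1) (T4GenFunBounds.abs_prodObs_le_one S h1 n os) ht

/-- **THE DRESSED LAW IS THE SOURCE TILT OF THE BOLTZMANN LAW**: `dU·ofReal(e^{tF_n}·e^{−βA}) = (dU·ofReal(e^{−βA}))·ofReal(e^{tF_n})` (`withDensity_mul`; the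
density on the left is, at the record, dag-n20-e's F3 `dressedStart` `e^{t·prodObs}·boltzmann` pointwise). [folklore] -/
theorem dressedLaw_eq_withDensity_boltzmannLaw (hm : ∀ K o, Measurable (S.obs K o)) (t : ℝ) :
    (fieldMeasure (S.P n) 0 G).withDensity (fun U => ENNReal.ofReal (Real.exp (t * prodObs S n os U) * boltzmann (S.P n) (S.β n) U)) =
      ((fieldMeasure (S.P n) 0 G).withDensity (fun U => ENNReal.ofReal (boltzmann (S.P n) (S.β n) U))).withDensity
        (fun U => ENNReal.ofReal (Real.exp (t * prodObs S n os U))) := by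
  have h1 : (fun U : GaugeField (S.P n) 0 G => ENNReal.ofReal (Real.exp (t * prodObs S n os U) * boltzmann (S.P n) (S.β n) U)) =
      (fun U : GaugeField (S.P n) 0 G => ENNReal.ofReal (boltzmann (S.P n) (S.β n) U)) *
        fun U : GaugeField (S.P n) 0 G => ENNReal.ofReal (Real.exp (t * prodObs S n os U)) := by
    funext U
    rw [Pi.mul_apply, mul_comm (Real.exp _), ENNReal.ofReal_mul (Missing.boltzmann_pos _ _ _).le]
  rw [h1]
  exact withDensity_mul _ (T4GenFunBounds.measurable_ofReal_boltzmann _ _) (measurable_ofReal_exp_source S n os hm t)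

/-- the dressed weight `e^{tF_n}·e^{−βA}` is integrable against the product Haar measure (`β_n ≥ 0`, `|obs| ≤ 1`). [folklore] -/
theorem integrable_dressedWeight (hβ : ∀ K, 0 ≤ S.β K) (hm : ∀ K o, Measurable (S.obs K o)) (h1 : ∀ K o U, |S.obs K o U| ≤ 1) (t : ℝ) :
    Integrable (fun U => Real.exp (t * prodObs S n os U) * boltzmann (S.P n) (S.β n) U) (fieldMeasure (S.P n) 0 G) := by
  refine (Missing.integrable_boltzmann RegularGaugeGroup.measurable_reTr (S.P n) (hβ n)).bdd_mul (c := Real.exp (|t| * 1))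
    (Real.measurable_exp.comp (measurable_const.mul (T4GenFunBounds.measurable_prodObs S hm n os))).aestronglyMeasurable
    (Filter.Eventually.of_forall fun U => ?_)
  rw [Real.norm_eq_abs, abs_of_pos (Real.exp_pos _)]
  exact T4GenFunBounds.exp_mul_le_of_abs_le (T4GenFunBounds.abs_prodObs_le_one S h1 n os U)

/-- **THE MASS OF THE DRESSED LAW IS THE DRESSED PARTITION FUNCTION** `schemeZ S os n t` — E1's right-hand side `Z_n(t)` as a measure identity. [folklore] -/
theorem dressedLaw_univ (hβ : ∀ K, 0 ≤ S.β K) (hm : ∀ K o, Measurable (S.obs K o)) (h1 : ∀ K o U, |S.obs K o U| ≤ 1) (t : ℝ) :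
    (fieldMeasure (S.P n) 0 G).withDensity (fun U => ENNReal.ofReal (Real.exp (t * prodObs S n os U) * boltzmann (S.P n) (S.β n) U)) univ =
      ENNReal.ofReal (schemeZ S os n t) := by
  rw [withDensity_apply _ MeasurableSet.univ, Measure.restrict_univ,
    ← ofReal_integral_eq_lintegral_ofReal (integrable_dressedWeight S n os hβ hm h1 t)
      (Filter.Eventually.of_forall fun U => (mul_pos (Real.exp_pos _) (Missing.boltzmann_pos _ _ _)).le)]
  rfl

/-- the mass of the Boltzmann law is the partition function `Z_n = schemeZ S os n 0` (`lintegral_boltzmann`, `dressedZ_zero`; any string `os`). [folklore] -/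
theorem boltzmannLaw_univ (hβ : ∀ K, 0 ≤ S.β K) :
    (fieldMeasure (S.P n) 0 G).withDensity (fun U => ENNReal.ofReal (boltzmann (S.P n) (S.β n) U)) univ = ENNReal.ofReal (schemeZ S os n 0) := by
  rw [withDensity_apply _ MeasurableSet.univ, Measure.restrict_univ, T4GenFunBounds.lintegral_boltzmann _ (hβ n)]
  exact congrArg ENNReal.ofReal (T4GenFunBounds.dressedZ_zero _ _ _).symm

/-- the Boltzmann law is a finite measure. [folklore] -/
theorem isFiniteMeasure_boltzmannLaw (hβ : ∀ K, 0 ≤ S.β K) :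
    IsFiniteMeasure ((fieldMeasure (S.P n) 0 G).withDensity (fun U => ENNReal.ofReal (boltzmann (S.P n) (S.β n) U))) :=
  ⟨by rw [withDensity_apply _ MeasurableSet.univ, Measure.restrict_univ, T4GenFunBounds.lintegral_boltzmann _ (hβ n)]; exact ENNReal.ofReal_lt_top⟩

/-- the dressed law is a finite measure. [folklore] -/
theorem isFiniteMeasure_dressedLaw (hβ : ∀ K, 0 ≤ S.β K) (hm : ∀ K o, Measurable (S.obs K o)) (h1 : ∀ K o U, |S.obs K o U| ≤ 1) (t : ℝ) :
    IsFiniteMeasure ((fieldMeasure (S.P n) 0 G).withDensity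
      (fun U => ENNReal.ofReal (Real.exp (t * prodObs S n os U) * boltzmann (S.P n) (S.β n) U))) :=
  ⟨by rw [dressedLaw_univ S n os hβ hm h1]; exact ENNReal.ofReal_lt_top⟩

/-- **(TILT), BOLTZMANN FORM**: the dressed law is sandwiched against the Boltzmann law with constant `e^{l₀}` on `|t| ≤ l₀` — module 20e's `htiltX` binder at the
level-0 laws of one run. [folklore] -/
theorem dressedLaw_sandwich (hm : ∀ K o, Measurable (S.obs K o)) (h1 : ∀ K o U, |S.obs K o U| ≤ 1) {l₀ t : ℝ} (ht : |t| ≤ l₀) :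
    (fieldMeasure (S.P n) 0 G).withDensity (fun U => ENNReal.ofReal (Real.exp (t * prodObs S n os U) * boltzmann (S.P n) (S.β n) U)) ≤
      ENNReal.ofReal (Real.exp l₀) • (fieldMeasure (S.P n) 0 G).withDensity (fun U => ENNReal.ofReal (boltzmann (S.P n) (S.β n) U)) ∧
    (fieldMeasure (S.P n) 0 G).withDensity (fun U => ENNReal.ofReal (boltzmann (S.P n) (S.β n) U)) ≤
      ENNReal.ofReal (Real.exp l₀) • (fieldMeasure (S.P n) 0 G).withDensity
        (fun U => ENNReal.ofReal (Real.exp (t * prodObs S n os U) * boltzmann (S.P n) (S.β n) U)) := by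
  rw [dressedLaw_eq_withDensity_boltzmannLaw S n os hm t]
  exact sourceTilt_sandwich S n os hm h1 _ ht

/-- … and on ANY common space: the images of the two laws under a measurable map `e` are sandwiched with the same constant. [folklore] -/
theorem dressedLaw_sandwich_map (hm : ∀ K o, Measurable (S.obs K o)) (h1 : ∀ K o U, |S.obs K o U| ≤ 1) {l₀ t : ℝ} (ht : |t| ≤ l₀)
    {Ω : Type*} [MeasurableSpace Ω] {e : GaugeField (S.P n) 0 G → Ω} (he : Measurable e) :
    ((fieldMeasure (S.P n) 0 G).withDensity (fun U => ENNReal.ofReal (Real.exp (t * prodObs S n os U) * boltzmann (S.P n) (S.β n) U))).map e ≤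
      ENNReal.ofReal (Real.exp l₀) • ((fieldMeasure (S.P n) 0 G).withDensity (fun U => ENNReal.ofReal (boltzmann (S.P n) (S.β n) U))).map e ∧
    ((fieldMeasure (S.P n) 0 G).withDensity (fun U => ENNReal.ofReal (boltzmann (S.P n) (S.β n) U))).map e ≤
      ENNReal.ofReal (Real.exp l₀) • ((fieldMeasure (S.P n) 0 G).withDensity
        (fun U => ENNReal.ofReal (Real.exp (t * prodObs S n os U) * boltzmann (S.P n) (S.β n) U))).map e :=
  sandwich_map (dressedLaw_sandwich S n os hm h1 ht) he

/-- the mass of the image of the dressed law under a measurable map is still `Z_n(t)`. [folklore] -/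
theorem dressedLaw_map_univ (hβ : ∀ K, 0 ≤ S.β K) (hm : ∀ K o, Measurable (S.obs K o)) (h1 : ∀ K o U, |S.obs K o U| ≤ 1) (t : ℝ)
    {Ω : Type*} [MeasurableSpace Ω] {e : GaugeField (S.P n) 0 G → Ω} (he : Measurable e) :
    ((fieldMeasure (S.P n) 0 G).withDensity (fun U => ENNReal.ofReal (Real.exp (t * prodObs S n os U) * boltzmann (S.P n) (S.β n) U))).map e univ =
      ENNReal.ofReal (schemeZ S os n t) := by
  rw [Measure.map_apply he MeasurableSet.univ, Set.preimage_univ, dressedLaw_univ S n os hβ hm h1 t]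

omit [RegularGaugeGroup G] in
/-- THE GIBBS LAW is the normalised Boltzmann law: `gibbsMeasure (S.P n) (S.β n) = Z⁻¹ • (dU·ofReal(e^{−βA}))` (definitional). [folklore] -/
theorem gibbsMeasure_eq_smul_boltzmannLaw :
    gibbsMeasure (S.P n) (S.β n) =
      (ENNReal.ofReal (partitionFn (G := G) (S.P n) (S.β n)))⁻¹ • (fieldMeasure (S.P n) 0 G).withDensity (fun U => ENNReal.ofReal (boltzmann (S.P n) (S.β n) U)) :=
  rfl

omit [GaugeGroup G] [HaarData G] [RegularGaugeGroup G] in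
/-- **(TILT), GIBBS FORM** (un-normalised tilt of the probability law): `gibbs·e^{tF_n} ≤ e^{l₀} • gibbs ∧ gibbs ≤ e^{l₀} • gibbs·e^{tF_n}`. [folklore] -/
theorem gibbsTilt_sandwich [GaugeGroup G] [HaarData G] (hm : ∀ K o, Measurable (S.obs K o)) (h1 : ∀ K o U, |S.obs K o U| ≤ 1) {l₀ t : ℝ} (ht : |t| ≤ l₀) :
    (gibbsMeasure (S.P n) (S.β n)).withDensity (fun U => ENNReal.ofReal (Real.exp (t * prodObs S n os U))) ≤
      ENNReal.ofReal (Real.exp l₀) • gibbsMeasure (G := G) (S.P n) (S.β n) ∧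
    gibbsMeasure (G := G) (S.P n) (S.β n) ≤
      ENNReal.ofReal (Real.exp l₀) • (gibbsMeasure (S.P n) (S.β n)).withDensity (fun U => ENNReal.ofReal (Real.exp (t * prodObs S n os U))) :=
  sourceTilt_sandwich S n os hm h1 _ ht

/-- the mass of the Gibbs law's un-normalised tilt is the mgf `Z_n(t)∕Z_n(0) = schemeZ S os n t ∕ schemeZ S os n 0` (`dressedZ_div_eq_mgf`). [folklore] -/
theorem gibbsTilt_univ (hβ : ∀ K, 0 ≤ S.β K) (hm : ∀ K o, Measurable (S.obs K o)) (h1 : ∀ K o U, |S.obs K o U| ≤ 1) (t : ℝ) :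
    (gibbsMeasure (S.P n) (S.β n)).withDensity (fun U => ENNReal.ofReal (Real.exp (t * prodObs S n os U))) univ =
      ENNReal.ofReal (schemeZ S os n t / schemeZ S os n 0) := by
  haveI : IsProbabilityMeasure (gibbsMeasure (G := G) (S.P n) (S.β n)) := T4GenFunBounds.isProbabilityMeasure_gibbsMeasure _ (hβ n)
  have hint : Integrable (fun U => Real.exp (t * prodObs S n os U)) (gibbsMeasure (G := G) (S.P n) (S.β n)) :=
    T4GenFunBounds.integrable_exp_mul_of_bound (T4GenFunBounds.measurable_prodObs S hm n os).aemeasurable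
      (Filter.Eventually.of_forall (T4GenFunBounds.abs_prodObs_le_one S h1 n os)) t
  rw [withDensity_apply _ MeasurableSet.univ, Measure.restrict_univ,
    ← ofReal_integral_eq_lintegral_ofReal hint (Filter.Eventually.of_forall fun U => (Real.exp_pos _).le)]
  exact congrArg ENNReal.ofReal (T4GenFunBounds.dressedZ_div_eq_mgf (G := G) (S.P n) (hβ n) _ t).symm

/-- **(TILT), PROBABILITY-LAW FORM**: the normalised source tilt `(gibbs).tilted (t·F_n)` — itself a probability law — is sandwiched against the Gibbs law with
constant `e^{2l₀}` (§1 `tilted_sandwich` at `B = 1`). [folklore] -/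
theorem gibbsTilted_sandwich (hβ : ∀ K, 0 ≤ S.β K) (hm : ∀ K o, Measurable (S.obs K o)) (h1 : ∀ K o U, |S.obs K o U| ≤ 1) {l₀ t : ℝ} (ht : |t| ≤ l₀) :
    (gibbsMeasure (S.P n) (S.β n)).tilted (fun U => t * prodObs S n os U) ≤ ENNReal.ofReal (Real.exp (2 * l₀)) • gibbsMeasure (G := G) (S.P n) (S.β n) ∧
    gibbsMeasure (G := G) (S.P n) (S.β n) ≤ ENNReal.ofReal (Real.exp (2 * l₀)) • (gibbsMeasure (S.P n) (S.β n)).tilted (fun U => t * prodObs S n os U) := by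
  haveI : IsProbabilityMeasure (gibbsMeasure (G := G) (S.P n) (S.β n)) := T4GenFunBounds.isProbabilityMeasure_gibbsMeasure _ (hβ n)
  simpa only [mul_one] using
    tilted_sandwich (gibbsMeasure (G := G) (S.P n) (S.β n)) (T4GenFunBounds.measurable_prodObs S hm n os) (B := 1)
      (T4GenFunBounds.abs_prodObs_le_one S h1 n os) ht

/-- the normalised source tilt of the Gibbs law is a probability law. [folklore] -/
theorem isProbabilityMeasure_gibbsTilted (hβ : ∀ K, 0 ≤ S.β K) (hm : ∀ K o, Measurable (S.obs K o)) (h1 : ∀ K o U, |S.obs K o U| ≤ 1) (t : ℝ) :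
    IsProbabilityMeasure ((gibbsMeasure (G := G) (S.P n) (S.β n)).tilted (fun U => t * prodObs S n os U)) := by
  haveI : IsProbabilityMeasure (gibbsMeasure (G := G) (S.P n) (S.β n)) := T4GenFunBounds.isProbabilityMeasure_gibbsMeasure _ (hβ n)
  exact isProbabilityMeasure_tilted (T4GenFunBounds.integrable_exp_mul_of_bound (T4GenFunBounds.measurable_prodObs S hm n os).aemeasurable
    (Filter.Eventually.of_forall (T4GenFunBounds.abs_prodObs_le_one S h1 n os)) t)

end Scheme

end Summit.QuantumFields.YangMills.Theorems.N21SourceTiltAtRecord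

end
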